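import Mathlib
import Literature.Computability.AlgebraicComplexity.PrattTrapezoidVal
import Summits.MatrixMultiplication.MatrixMultiplication.Theorems.EisensteinValCertificatesPrimeValSavingPrimeThird

/-!
# The density threshold `1/3` and the constant `3^{-3/2}` at prime modulus: `∀ ε` forms

Companion of `…PrimeValSavingPrimeThird` (support for route `MatrixMultiplication/EisensteinValCertificates`,
cruxes `stmt-MatrixMultiplication-7788` `PrimeValSaving`, stmt-7790 `PrimeFourThirdsSaving`):

* `min_card_le_third` : for every `ε > 0` and all sufficiently large primes `p`, every
  equilateral-trapezoid-free `(A, B, C)` in `ℤ/p` has **`min(#A, #B, #C) ≤ (1/3 + ε)·p`** (sharp: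
  `A = B = C ⊂ (p/3, 2p/3)` is vacuously trapezoid-free).
* `prattVal_sq_le_of_prime` : **`Val(ℤ/p)² ≤ (1/27 + ε)·p³`** for all sufficiently large primes, i.e.
  `Val(ℤ/p) ≤ (3^{-3/2} + o(1))·p^{3/2}` (Pratt Prop. 3.4 has `p^{3/2}`; `2^{-3/2}|G|^{3/2} + O(|G|)`
  holds in every abelian group and `2^{-3/2}` is attained in `ℤ/8`).

Both follow from the explicit `t, ρ` forms of the companion file by taking `t ≍ εp`, `ρ ≍ ε²p`.
[cite: Pratt2024, Def. 3.2, Prop. 3.4] [cite: Pollard1974, Thm. 1]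
-/

-- single-conjunct summit: the mandated namespace repeats `MatrixMultiplication`.
set_option linter.dupNamespace false

namespace Summit.MatrixMultiplication.MatrixMultiplication.Theorems

namespace PrattValPrimeThirdEpsilon

open Finset Literature.Computability.AlgebraicComplexity PrattValPrimeThird


/-- **Sharp density threshold at prime modulus.** For every `ε > 0` and all sufficiently large
primes `p`, every equilateral-trapezoid-free triple `(A, B, C)` in `ℤ/p` has
`min(#A, #B, #C) ≤ (1/3 + ε)·p`; the constant `1/3` is attained (vacuously) by
`A = B = C ⊂ (p/3, 2p/3)`. [cite: Pratt2024, Def. 3.2] [cite: Pollard1974, Thm. 1] -/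
theorem min_card_le_third (ε : ℝ) (hε : 0 < ε) :
    ∃ p₀ : ℕ, ∀ q : ℕ, p₀ ≤ q → q.Prime → ∀ A B C : Finset (ZMod q),
      IsEquilateralTrapezoidFree A B C → ((min (min #A #B) #C : ℕ) : ℝ) ≤ (1 / 3 + ε) * q := by
  refine ⟨⌈6912 / ε ^ 5 + 48 / ε ^ 2 + 8 / ε⌉₊ + 1, fun q hq0 hq A B C h => ?_⟩
  haveI : Fact q.Prime := ⟨hq⟩
  have hqR : (6912 / ε ^ 5 + 48 / ε ^ 2 + 8 / ε : ℝ) < q := by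
    have h1 := Nat.le_ceil (6912 / ε ^ 5 + 48 / ε ^ 2 + 8 / ε)
    have h2 : ((⌈6912 / ε ^ 5 + 48 / ε ^ 2 + 8 / ε⌉₊ + 1 : ℕ) : ℝ) ≤ q := by exact_mod_cast hq0
    push_cast at h2
    linarith
  have hpos1 : (0 : ℝ) ≤ 6912 / ε ^ 5 := by positivity
  have hpos2 : (0 : ℝ) ≤ 48 / ε ^ 2 := by positivity
  have hpos3 : (0 : ℝ) ≤ 8 / ε := by positivity
  have hεq : 8 ≤ ε * q := by
    have h1 : ε * (8 / ε) ≤ ε * q := mul_le_mul_of_nonneg_left (by linarith) hε.le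
    have h2 : ε * (8 / ε) = 8 := by field_simp
    linarith
  have hε2q : 48 ≤ ε ^ 2 * q := by
    have h1 : ε ^ 2 * (48 / ε ^ 2) ≤ ε ^ 2 * q := mul_le_mul_of_nonneg_left (by linarith) (by positivity)
    have h2 : ε ^ 2 * (48 / ε ^ 2) = 48 := by field_simp
    linarith
  have hε5q : 6912 ≤ ε ^ 5 * q := by
    have h1 : ε ^ 5 * (6912 / ε ^ 5) ≤ ε ^ 5 * q := mul_le_mul_of_nonneg_left (by linarith) (by positivity)
    have h2 : ε ^ 5 * (6912 / ε ^ 5) = 6912 := by field_simp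
    linarith
  set t : ℕ := ⌊ε * q / 4⌋₊ with htdef
  set ρ : ℕ := ⌊ε ^ 2 * q / 24⌋₊ with hρdef
  have htle : (t : ℝ) ≤ ε * q / 4 := Nat.floor_le (by positivity)
  have htge : ε * q / 4 - 1 ≤ t := by have := Nat.lt_floor_add_one (ε * q / 4); linarith
  have hρle : (ρ : ℝ) ≤ ε ^ 2 * q / 24 := Nat.floor_le (by positivity)
  have hρge : ε ^ 2 * q / 24 - 1 ≤ ρ := by have := Nat.lt_floor_add_one (ε ^ 2 * q / 24); linarith
  have ht1R : (1 : ℝ) ≤ t := by linarith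
  have hρ1R : (1 : ℝ) ≤ ρ := by linarith
  have ht1 : 1 ≤ t := by exact_mod_cast ht1R
  have hρ1 : 1 ≤ ρ := by exact_mod_cast hρ1R
  have main := three_mul_min_card_le h ht1 hρ1
  have mainR : (3 : ℝ) * ((min (min #A #B) #C : ℕ) : ℝ) ≤
      q + 4 * t + 3 * ((ρ * q / t : ℕ) : ℝ) + 3 * ((q ^ 2 / ρ ^ 2 : ℕ) : ℝ) := by
    exact_mod_cast main
  have hd1 : ((ρ * q / t : ℕ) : ℝ) ≤ (ρ : ℝ) * q / t := by
    have := Nat.cast_div_le (m := ρ * q) (n := t) (α := ℝ)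
    push_cast at this
    exact this
  have hd2 : ((q ^ 2 / ρ ^ 2 : ℕ) : ℝ) ≤ (q : ℝ) ^ 2 / (ρ : ℝ) ^ 2 := by
    have := Nat.cast_div_le (m := q ^ 2) (n := ρ ^ 2) (α := ℝ)
    push_cast at this
    exact this
  have htq8 : ε * q / 8 ≤ t := by linarith
  have hρ48 : ε ^ 2 * q / 48 ≤ ρ := by linarith
  have htpos : (0 : ℝ) < t := by linarith
  have hρpos : (0 : ℝ) < ρ := by linarith
  have hb1 : (ρ : ℝ) * q / t ≤ ε * q / 3 := by
    rw [div_le_iff₀ htpos]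
    have hq0 : (0 : ℝ) ≤ q := Nat.cast_nonneg _
    have h1 : (ρ : ℝ) * q ≤ ε ^ 2 * q / 24 * q := mul_le_mul_of_nonneg_right hρle hq0
    have h2 : ε ^ 2 * q / 24 * q ≤ ε * q / 3 * t := by
      have : ε ^ 2 * q / 24 * q = ε * q / 3 * (ε * q / 8) := by ring
      rw [this]
      exact mul_le_mul_of_nonneg_left htq8 (by positivity)
    linarith
  have hb2 : (q : ℝ) ^ 2 / (ρ : ℝ) ^ 2 ≤ 2304 / ε ^ 4 := by
    rw [div_le_div_iff₀ (by positivity) (by positivity)]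
    have h1 : ε ^ 2 * q ≤ 48 * ρ := by linarith
    have h2 : 0 ≤ ε ^ 2 * q := by positivity
    nlinarith [mul_le_mul h1 h1 h2 (by positivity)]
  have hb3 : (3 : ℝ) * (2304 / ε ^ 4) ≤ ε * q := by
    have h1 : (3 : ℝ) * (2304 / ε ^ 4) = 6912 / ε ^ 5 * ε := by field_simp; ring
    have h2 : 6912 / ε ^ 5 * ε ≤ q * ε := by
      have : (6912 : ℝ) / ε ^ 5 ≤ q := by linarith
      exact mul_le_mul_of_nonneg_right this hε.le
    linarith
  have h3 : (3 : ℝ) * ((min (min #A #B) #C : ℕ) : ℝ) ≤ q + 3 * (ε * q) := by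
    have e1 : (4 : ℝ) * t ≤ ε * q := by linarith
    have e2 : 3 * ((ρ * q / t : ℕ) : ℝ) ≤ ε * q := by linarith
    have e3 : 3 * ((q ^ 2 / ρ ^ 2 : ℕ) : ℝ) ≤ ε * q := by linarith
    linarith
  have h8 : (1 / 3 + ε) * (q : ℝ) = (q + 3 * (ε * q)) / 3 := by ring
  rw [h8, le_div_iff₀ (by norm_num)]
  linarith

/-- **The constant at prime modulus**: `Val(ℤ/p)² ≤ (1/27 + ε)·p³` for every `ε > 0` and all
sufficiently large primes `p`, i.e. `Val(ℤ/p) ≤ (3^{-3/2} + o(1))·p^{3/2} ≈ 0.192·p^{3/2}`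
(Pratt Prop. 3.4: `≤ p^{3/2}`; every abelian group: `≤ 2^{-3/2}|G|^{3/2} + (3/2)|G|`,
`PrattValConstant.prattVal_le_rpow`, with `2^{-3/2}` attained in `ℤ/8`).
[cite: Pratt2024, Prop. 3.4] [cite: Pollard1974, Thm. 1] -/
theorem prattVal_sq_le_of_prime (ε : ℝ) (hε : 0 < ε) :
    ∃ p₀ : ℕ, ∀ (q : ℕ) [Fact q.Prime], p₀ ≤ q →
      ((prattVal (ZMod q) : ℕ) : ℝ) ^ 2 ≤ (1 / 27 + ε) * (q : ℝ) ^ 3 := by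
  -- work with `η = min ε 1 / 2 ≤ 1/2`
  set η : ℝ := min ε 1 / 2 with hηdef
  have hη : 0 < η := by rw [hηdef]; positivity
  have hη1 : η ≤ 1 / 2 := by
    rw [hηdef]; have := min_le_right ε 1; linarith
  have hηε : 2 * η ≤ ε := by
    rw [hηdef]; have := min_le_left ε 1; linarith
  clear_value η
  refine ⟨⌈3888 / η ^ 5 + 72 / η ^ 2 + 12 / η⌉₊ + 1, fun q _ hq0 => ?_⟩
  have hqR : (3888 / η ^ 5 + 72 / η ^ 2 + 12 / η : ℝ) < q := by
    have h1 := Nat.le_ceil (3888 / η ^ 5 + 72 / η ^ 2 + 12 / η)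
    have h2 : ((⌈3888 / η ^ 5 + 72 / η ^ 2 + 12 / η⌉₊ + 1 : ℕ) : ℝ) ≤ q := by exact_mod_cast hq0
    push_cast at h2
    linarith
  have hpos1 : (0 : ℝ) ≤ 3888 / η ^ 5 := by positivity
  have hpos2 : (0 : ℝ) ≤ 72 / η ^ 2 := by positivity
  have hpos3 : (0 : ℝ) ≤ 12 / η := by positivity
  have hηq : 12 ≤ η * q := by
    have h1 : η * (12 / η) ≤ η * q := mul_le_mul_of_nonneg_left (by linarith) hη.le
    have h2 : η * (12 / η) = 12 := by field_simp
    linarith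
  have hη2q : 72 ≤ η ^ 2 * q := by
    have h1 : η ^ 2 * (72 / η ^ 2) ≤ η ^ 2 * q := mul_le_mul_of_nonneg_left (by linarith) (by positivity)
    have h2 : η ^ 2 * (72 / η ^ 2) = 72 := by field_simp
    linarith
  have hη5q : 3888 ≤ η ^ 5 * q := by
    have h1 : η ^ 5 * (3888 / η ^ 5) ≤ η ^ 5 * q := mul_le_mul_of_nonneg_left (by linarith) (by positivity)
    have h2 : η ^ 5 * (3888 / η ^ 5) = 3888 := by field_simp
    linarith
  set t : ℕ := ⌊η * q / 3⌋₊ with htdef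
  set ρ : ℕ := ⌊η ^ 2 * q / 18⌋₊ with hρdef
  have htle : (t : ℝ) ≤ η * q / 3 := Nat.floor_le (by positivity)
  have htge : η * q / 3 - 1 ≤ t := by have := Nat.lt_floor_add_one (η * q / 3); linarith
  have hρle : (ρ : ℝ) ≤ η ^ 2 * q / 18 := Nat.floor_le (by positivity)
  have hρge : η ^ 2 * q / 18 - 1 ≤ ρ := by have := Nat.lt_floor_add_one (η ^ 2 * q / 18); linarith
  have ht1R : (1 : ℝ) ≤ t := by linarith
  have hρ1R : (1 : ℝ) ≤ ρ := by linarith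
  have ht1 : 1 ≤ t := by exact_mod_cast ht1R
  have hρ1 : 1 ≤ ρ := by exact_mod_cast hρ1R
  have main := prattVal_sq_le q ht1 hρ1
  -- cast and bound `S = t + q²/ρ² + ρq/t ≤ η q`
  set S : ℕ := t + q ^ 2 / ρ ^ 2 + ρ * q / t with hSdef
  have mainR : (27 : ℝ) * ((prattVal (ZMod q) : ℕ) : ℝ) ^ 2 ≤
      ((q : ℝ) + S) ^ 3 + 27 * (q : ℝ) ^ 2 * S := by
    exact_mod_cast main
  have hd1 : ((ρ * q / t : ℕ) : ℝ) ≤ (ρ : ℝ) * q / t := by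
    have := Nat.cast_div_le (m := ρ * q) (n := t) (α := ℝ)
    push_cast at this
    exact this
  have hd2 : ((q ^ 2 / ρ ^ 2 : ℕ) : ℝ) ≤ (q : ℝ) ^ 2 / (ρ : ℝ) ^ 2 := by
    have := Nat.cast_div_le (m := q ^ 2) (n := ρ ^ 2) (α := ℝ)
    push_cast at this
    exact this
  have htq6 : η * q / 6 ≤ t := by linarith
  have hρ36 : η ^ 2 * q / 36 ≤ ρ := by linarith
  have htpos : (0 : ℝ) < t := by linarith
  have hρpos : (0 : ℝ) < ρ := by linarith
  have hb1 : (ρ : ℝ) * q / t ≤ η * q / 3 := by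
    rw [div_le_iff₀ htpos]
    have hq0' : (0 : ℝ) ≤ q := Nat.cast_nonneg _
    have h1 : (ρ : ℝ) * q ≤ η ^ 2 * q / 18 * q := mul_le_mul_of_nonneg_right hρle hq0'
    have h2 : η ^ 2 * q / 18 * q ≤ η * q / 3 * t := by
      have : η ^ 2 * q / 18 * q = η * q / 3 * (η * q / 6) := by ring
      rw [this]
      exact mul_le_mul_of_nonneg_left htq6 (by positivity)
    linarith
  have hb2 : (q : ℝ) ^ 2 / (ρ : ℝ) ^ 2 ≤ 1296 / η ^ 4 := by
    rw [div_le_div_iff₀ (by positivity) (by positivity)]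
    have h1 : η ^ 2 * q ≤ 36 * ρ := by linarith only [hρ36]
    have h2 : 0 ≤ η ^ 2 * q := by positivity
    have h3 := mul_le_mul h1 h1 h2 (by positivity)
    rw [show (q : ℝ) ^ 2 * η ^ 4 = η ^ 2 * q * (η ^ 2 * q) by ring,
      show (1296 : ℝ) * (ρ : ℝ) ^ 2 = 36 * ρ * (36 * ρ) by ring]
    exact h3
  have hb3 : (1296 : ℝ) / η ^ 4 ≤ η * q / 3 := by
    have h1 : (1296 : ℝ) / η ^ 4 = 3888 / η ^ 5 * η / 3 := by field_simp; ring
    have h2 : 3888 / η ^ 5 * η ≤ q * η := by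
      have : (3888 : ℝ) / η ^ 5 ≤ q := by linarith
      exact mul_le_mul_of_nonneg_right this hη.le
    rw [h1]
    linarith
  have hS : (S : ℝ) ≤ η * q := by
    have : (S : ℝ) = t + ((q ^ 2 / ρ ^ 2 : ℕ) : ℝ) + ((ρ * q / t : ℕ) : ℝ) := by
      rw [hSdef]; push_cast; ring
    rw [this]
    linarith
  have hS0 : (0 : ℝ) ≤ S := Nat.cast_nonneg _
  have hq0 : (0 : ℝ) ≤ q := Nat.cast_nonneg _
  -- `(q + S)³ + 27 q² S ≤ q³ ((1+η)³ + 27η) ≤ q³ (1 + 59 η)` using `η ≤ 1/2`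
  have hpow : ((q : ℝ) + S) ^ 3 ≤ ((1 + η) * q) ^ 3 := by
    have h1 : (q : ℝ) + S ≤ (1 + η) * q := by linarith only [hS]
    exact pow_le_pow_left₀ (by positivity) h1 3
  have hcube : ((1 + η) * (q : ℝ)) ^ 3 ≤ (1 + 5 * η) * (q : ℝ) ^ 3 := by
    have h1 : (1 + η) ^ 3 ≤ 1 + 5 * η := by
      have e : (1 + η) ^ 3 = 1 + 3 * η + 3 * η ^ 2 + η ^ 3 := by ring
      have hη2 : η ^ 2 ≤ η / 2 := by
        have := mul_le_mul_of_nonneg_left hη1 hη.le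
        calc η ^ 2 = η * η := sq η
          _ ≤ η * (1 / 2) := this
          _ = η / 2 := by ring
      have hη3 : η ^ 3 ≤ η / 4 := by
        have := mul_le_mul_of_nonneg_left hη2 hη.le
        calc η ^ 3 = η * η ^ 2 := by ring
          _ ≤ η * (η / 2) := this
          _ = η ^ 2 / 2 := by ring
          _ ≤ (η / 2) / 2 := by linarith only [hη2]
          _ = η / 4 := by ring
      rw [e]; linarith
    have h2 : ((1 + η) * (q : ℝ)) ^ 3 = (1 + η) ^ 3 * (q : ℝ) ^ 3 := by ring
    rw [h2]
    exact mul_le_mul_of_nonneg_right h1 (by positivity)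
  have h27S : 27 * (q : ℝ) ^ 2 * S ≤ 27 * η * (q : ℝ) ^ 3 := by
    have : 27 * (q : ℝ) ^ 2 * S ≤ 27 * (q : ℝ) ^ 2 * (η * q) :=
      mul_le_mul_of_nonneg_left hS (by positivity)
    linarith
  have hfin : (27 : ℝ) * ((prattVal (ZMod q) : ℕ) : ℝ) ^ 2 ≤ (1 + 32 * η) * (q : ℝ) ^ 3 := by
    linarith
  -- divide by 27: `V² ≤ (1/27 + 32η/27) q³ ≤ (1/27 + 2η) q³ ≤ (1/27 + ε) q³`
  have hq3 : (0 : ℝ) ≤ (q : ℝ) ^ 3 := by positivity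
  have hηq3 : 2 * η * (q : ℝ) ^ 3 ≤ ε * (q : ℝ) ^ 3 := mul_le_mul_of_nonneg_right hηε hq3
  have e : (1 / 27 + ε) * (q : ℝ) ^ 3 = (q : ℝ) ^ 3 / 27 + ε * (q : ℝ) ^ 3 := by ring
  have hpos : 0 ≤ η * (q : ℝ) ^ 3 := mul_nonneg hη.le hq3
  rw [e]
  linarith only [hfin, hηq3, hpos]

end PrattValPrimeThirdEpsilon

end Summit.MatrixMultiplication.MatrixMultiplication.Theorems
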